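import Literature.MathematicalPhysics.QuantumLattice.FermiRG.BGM2006Sec2ShellLineBounds
import Literature.Analysis.Calculus.SecondDifferenceBound
import HarnessLib

/-!
# The infrared field cutoff `H₀(√(ν² + e²))` as a `C²` symbol: second differences in the frequency and along band lines

Topic `MathematicalPhysics/QuantumLattice`; the MULTIPLIER companion of `HubbardUVSymbolSmooth` / `HubbardSliceSymbolSmooth(Momentum)`
(cell gate-hubbard-kl: there the covariance symbols `w·βL²/(-iω+e)`; here the support function of the fields of scales `≤ 0`,
`C₀⁻¹(√(ν²+e²)) = gnCutoff 4 e₀ (√(ν²+e²)) = G(ν² + e²)` with `G = bgmCutoffSq e₀` the smooth squared-modulus form of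
`BGM2006Sec2ShellLineBounds` — the first factor of the sector multipliers `bgmMultiplier e₀ β e 0 ω` of `SectorisedKernelNorm`).
Benfatto–Giuliani–Mastropietro 2006, §2.5 (2.45)–(2.48) and the proof of Lemma 2.2 ((2.36aa): every derivative of a scale-`h`
symbol costs `γ^{-h}`; here `h = 0`, so the costs are absolute constants depending on `e₀` only):

* `exists_deriv_bounds_bgmCutoffSq` — `G` is `C²` with GLOBALLY bounded first and second derivatives `B₁, B₂` (they vanish off
  `[e₀²/16, e₀²]`, where `G` is locally constant), and `G′ = G″ = 0` above `e₀²`;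
* **`exists_second_difference_freq_le`** — `∃ C ≥ 0`: `|G((ν+2δ)²+e²) - 2G((ν+δ)²+e²) + G(ν²+e²)| ≤ δ²·C` for all `e, ν, δ ≥ 0`
  (the Matsubara direction of the padded symbol, `δ = 2π/β`);
* **`exists_second_difference_line_le`** — `∃ B₁ B₂ ≥ 0`: along any `C²` band line `a` (`|a′|, |a″| ≤ D`) times any `C²` angular
  factor `Z` (`|Z| ≤ 1`, `|Z′| ≤ Z₁`, `|Z″| ≤ Z₂`) the symbol `t ↦ G(ν² + a(t)²)·Z(t)` has
  `|Δ²_δ| ≤ δ²·(4B₂e₀²D² + 2B₁(D² + e₀D) + 4B₁e₀D·Z₁ + Z₂)` (the momentum directions, `δ = 2π/L`; the band line and the angular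
  factor are supplied by the frame: `HubbardUVSymbolCTDifferences.UVLineBound`, `AngularCutoffLineBounds`).

Everything is proved; no definitions, no named facts (the constants are existential but depend on `e₀` only).

## Sources

G. Benfatto, A. Giuliani, V. Mastropietro, Ann. Henri Poincaré 7 (2006) 809–898, §2.2 (2.9), §2.5 (2.45)–(2.48), Lemma 2.2 with
(2.36aa) [`BenfattoGiulianiMastropietro2006`].
-/

noncomputable section

namespace Literature.MathematicalPhysics.QuantumLattice

open Set Filter Literature.MathematicalPhysics.QuantumLattice.FermiRG Literature.Analysis
open scoped Topology

/-! ### §1 The squared-modulus cutoff `G = bgmCutoffSq e₀` has bounded first and second derivatives -/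

/-- `G(u) = 0` for `u ≥ e₀²` (`H₀(t) = 0` for `t ≥ e₀`). [cite: BenfattoGiulianiMastropietro2006, §2.2 (2.9)] -/
theorem bgmCutoffSq_eq_zero_of_le {e₀ : ℝ} (he : 0 < e₀) {u : ℝ} (hu : e₀ ^ 2 ≤ u) : bgmCutoffSq e₀ u = 0 := by
  rw [bgmCutoffSq]
  refine gnCutoff_eq_zero (by norm_num) he ?_
  calc e₀ = Real.sqrt (e₀ ^ 2) := (Real.sqrt_sq he.le).symm
    _ ≤ Real.sqrt u := Real.sqrt_le_sqrt hu

/-- `G(u) = 1` for `u ≤ e₀²/16` (`H₀(t) = 1` for `t ≤ e₀/4`). [cite: BenfattoGiulianiMastropietro2006, §2.2 (2.9)] -/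
theorem bgmCutoffSq_eq_one_of_le {e₀ : ℝ} (he : 0 < e₀) {u : ℝ} (hu : u ≤ e₀ ^ 2 / 16) : bgmCutoffSq e₀ u = 1 := by
  rw [bgmCutoffSq]
  refine gnCutoff_eq_one (by norm_num) he ?_
  calc Real.sqrt u ≤ Real.sqrt (e₀ ^ 2 / 16) := Real.sqrt_le_sqrt hu
    _ = e₀ / 4 := by
        rw [show e₀ ^ 2 / 16 = (e₀ / 4) ^ 2 by ring, Real.sqrt_sq (by positivity)]

/-- **`G` is `C²` with globally bounded derivatives, vanishing above `e₀²`**: there are `B₁, B₂ ≥ 0` with `|G′| ≤ B₁`, `|G″| ≤ B₂`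
everywhere, `G′(u) = G″(u) = 0` for `u > e₀²`, and `G`, `G′` are differentiable with derivatives `G′ = deriv G`,
`G″ = deriv (deriv G)`. [cite: BenfattoGiulianiMastropietro2006, §2.2 (2.9)] -/
theorem exists_deriv_bounds_bgmCutoffSq {e₀ : ℝ} (he : 0 < e₀) :
    ∃ B₁ B₂ : ℝ, 0 ≤ B₁ ∧ 0 ≤ B₂ ∧
      (∀ u, HasDerivAt (bgmCutoffSq e₀) (deriv (bgmCutoffSq e₀) u) u) ∧
      (∀ u, HasDerivAt (deriv (bgmCutoffSq e₀)) (deriv (deriv (bgmCutoffSq e₀)) u) u) ∧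
      (∀ u, |deriv (bgmCutoffSq e₀) u| ≤ B₁) ∧ (∀ u, |deriv (deriv (bgmCutoffSq e₀)) u| ≤ B₂) ∧
      (∀ u, e₀ ^ 2 < u → deriv (bgmCutoffSq e₀) u = 0 ∧ deriv (deriv (bgmCutoffSq e₀)) u = 0) := by
  set G := bgmCutoffSq e₀ with hG
  have hGinf := contDiff_bgmCutoffSq he (m := ⊤)
  have h1 := contDiff_infty_iff_deriv.1 hGinf
  have h2 := contDiff_infty_iff_deriv.1 h1.2
  have hGd : Differentiable ℝ G := h1.1
  have hG'd : Differentiable ℝ (deriv G) := h2.1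
  have hcont1 : Continuous (deriv G) := h1.2.continuous
  have hcont2 : Continuous (deriv (deriv G)) := h2.2.continuous
  -- local constancy off `[e₀²/16, e₀²]`
  have hzero_above : ∀ u, e₀ ^ 2 < u → deriv G u = 0 ∧ deriv (deriv G) u = 0 := by
    intro u hu
    have hev : G =ᶠ[𝓝 u] fun _ => (0 : ℝ) := by
      filter_upwards [Ioi_mem_nhds hu] with v hv
      exact bgmCutoffSq_eq_zero_of_le he (le_of_lt hv)
    have hev' : deriv G =ᶠ[𝓝 u] fun _ => (0 : ℝ) := by
      filter_upwards [Ioi_mem_nhds hu] with v hv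
      have hv' : G =ᶠ[𝓝 v] fun _ => (0 : ℝ) := by
        filter_upwards [Ioi_mem_nhds hv] with w hw
        exact bgmCutoffSq_eq_zero_of_le he (le_of_lt hw)
      rw [hv'.deriv_eq, deriv_const]
    refine ⟨by rw [hev.deriv_eq, deriv_const], by rw [hev'.deriv_eq, deriv_const]⟩
  have hzero_below : ∀ u, u < e₀ ^ 2 / 16 → deriv G u = 0 ∧ deriv (deriv G) u = 0 := by
    intro u hu
    have hev : G =ᶠ[𝓝 u] fun _ => (1 : ℝ) := by
      filter_upwards [Iio_mem_nhds hu] with v hv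
      exact bgmCutoffSq_eq_one_of_le he (le_of_lt hv)
    have hev' : deriv G =ᶠ[𝓝 u] fun _ => (0 : ℝ) := by
      filter_upwards [Iio_mem_nhds hu] with v hv
      have hv' : G =ᶠ[𝓝 v] fun _ => (1 : ℝ) := by
        filter_upwards [Iio_mem_nhds hv] with w hw
        exact bgmCutoffSq_eq_one_of_le he (le_of_lt hw)
      rw [hv'.deriv_eq, deriv_const]
    refine ⟨by rw [hev.deriv_eq, deriv_const], by rw [hev'.deriv_eq, deriv_const]⟩
  -- bounds on the compact interval `[0, e₀²]`
  obtain ⟨C₁, hC₁⟩ := (isCompact_Icc (a := (0 : ℝ)) (b := e₀ ^ 2)).exists_bound_of_continuousOn hcont1.continuousOn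
  obtain ⟨C₂, hC₂⟩ := (isCompact_Icc (a := (0 : ℝ)) (b := e₀ ^ 2)).exists_bound_of_continuousOn hcont2.continuousOn
  refine ⟨max C₁ 0, max C₂ 0, le_max_right _ _, le_max_right _ _, fun u => (hGd u).hasDerivAt, fun u => (hG'd u).hasDerivAt,
    fun u => ?_, fun u => ?_, hzero_above⟩
  · by_cases h1 : e₀ ^ 2 < u
    · rw [(hzero_above u h1).1, abs_zero]; exact le_max_right _ _
    by_cases h2 : u < 0
    · have : u < e₀ ^ 2 / 16 := lt_of_lt_of_le h2 (by positivity)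
      rw [(hzero_below u this).1, abs_zero]; exact le_max_right _ _
    · have hu : u ∈ Icc (0 : ℝ) (e₀ ^ 2) := ⟨le_of_not_gt h2, le_of_not_gt h1⟩
      exact ((Real.norm_eq_abs _).symm.le.trans (hC₁ u hu)).trans (le_max_left _ _)
  · by_cases h1 : e₀ ^ 2 < u
    · rw [(hzero_above u h1).2, abs_zero]; exact le_max_right _ _
    by_cases h2 : u < 0
    · have : u < e₀ ^ 2 / 16 := lt_of_lt_of_le h2 (by positivity)
      rw [(hzero_below u this).2, abs_zero]; exact le_max_right _ _
    · have hu : u ∈ Icc (0 : ℝ) (e₀ ^ 2) := ⟨le_of_not_gt h2, le_of_not_gt h1⟩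
      exact ((Real.norm_eq_abs _).symm.le.trans (hC₂ u hu)).trans (le_max_left _ _)

/-! ### §2 The frequency direction: `ν ↦ G(ν² + e²)` -/

/-- **Second differences of the cutoff in the frequency**: `∃ C ≥ 0` (depending on `e₀` only) with
`|G((ν+2δ)²+e²) - 2G((ν+δ)²+e²) + G(ν²+e²)| ≤ δ²·C` for all `e, ν` and `δ ≥ 0` — in fact `C = 4e₀²B₂ + 2B₁`: where `G′, G″ ≠ 0`
one has `ν² ≤ ν² + e² ≤ e₀²`. [cite: BenfattoGiulianiMastropietro2006, §2.5 Lemma 2.2 (2.36aa)] -/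
theorem exists_second_difference_freq_le {e₀ : ℝ} (he : 0 < e₀) :
    ∃ C : ℝ, 0 ≤ C ∧ ∀ (e ν δ : ℝ), 0 ≤ δ →
      |bgmCutoffSq e₀ ((ν + 2 * δ) ^ 2 + e ^ 2) - 2 * bgmCutoffSq e₀ ((ν + δ) ^ 2 + e ^ 2) + bgmCutoffSq e₀ (ν ^ 2 + e ^ 2)| ≤
        δ ^ 2 * C := by
  obtain ⟨B₁, B₂, hB₁, hB₂, hd1, hd2, hb1, hb2, hzero⟩ := exists_deriv_bounds_bgmCutoffSq he
  set G := bgmCutoffSq e₀ with hG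
  refine ⟨4 * e₀ ^ 2 * B₂ + 2 * B₁, by positivity, fun e ν δ hδ => ?_⟩
  -- the function and its first two derivatives along the frequency
  set f : ℝ → ℝ := fun t => G (t ^ 2 + e ^ 2) with hf
  set f' : ℝ → ℝ := fun t => deriv G (t ^ 2 + e ^ 2) * (2 * t) with hf'
  set f'' : ℝ → ℝ := fun t => deriv (deriv G) (t ^ 2 + e ^ 2) * (2 * t) * (2 * t) + deriv G (t ^ 2 + e ^ 2) * 2 with hf''
  have hu : ∀ t, HasDerivAt (fun t : ℝ => t ^ 2 + e ^ 2) (2 * t) t := fun t => by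
    have h := ((hasDerivAt_pow 2 t).add_const (e ^ 2))
    simpa using h
  have hf1 : ∀ t, HasDerivAt f (f' t) t := fun t => by
    have h : HasDerivAt (G ∘ fun s : ℝ => s ^ 2 + e ^ 2) (deriv G (t ^ 2 + e ^ 2) * (2 * t)) t :=
      (hd1 (t ^ 2 + e ^ 2)).comp t (hu t)
    exact h
  have hf2 : ∀ t, HasDerivAt f' (f'' t) t := fun t => by
    have h1 : HasDerivAt (deriv G ∘ fun s : ℝ => s ^ 2 + e ^ 2) (deriv (deriv G) (t ^ 2 + e ^ 2) * (2 * t)) t :=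
      (hd2 (t ^ 2 + e ^ 2)).comp t (hu t)
    have h2 : HasDerivAt (fun s : ℝ => 2 * s) 2 t := by simpa using (hasDerivAt_id t).const_mul 2
    exact h1.mul h2
  have hbound : ∀ t, ‖f'' t‖ ≤ 4 * e₀ ^ 2 * B₂ + 2 * B₁ := by
    intro t
    rw [Real.norm_eq_abs, hf'']
    dsimp only
    by_cases hbig : e₀ ^ 2 < t ^ 2 + e ^ 2
    · rw [(hzero _ hbig).1, (hzero _ hbig).2]
      simp only [zero_mul, add_zero, abs_zero]
      positivity
    · have ht2 : t ^ 2 ≤ e₀ ^ 2 := by nlinarith [sq_nonneg e]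
      have e1 : deriv (deriv G) (t ^ 2 + e ^ 2) * (2 * t) * (2 * t) = deriv (deriv G) (t ^ 2 + e ^ 2) * (4 * t ^ 2) := by ring
      calc |deriv (deriv G) (t ^ 2 + e ^ 2) * (2 * t) * (2 * t) + deriv G (t ^ 2 + e ^ 2) * 2|
          ≤ |deriv (deriv G) (t ^ 2 + e ^ 2) * (2 * t) * (2 * t)| + |deriv G (t ^ 2 + e ^ 2) * 2| := abs_add_le _ _
        _ = |deriv (deriv G) (t ^ 2 + e ^ 2)| * (4 * t ^ 2) + |deriv G (t ^ 2 + e ^ 2)| * 2 := by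
            rw [e1, abs_mul (deriv (deriv G) (t ^ 2 + e ^ 2)) (4 * t ^ 2), abs_mul (deriv G (t ^ 2 + e ^ 2)) 2,
              abs_of_nonneg (by positivity : (0 : ℝ) ≤ 4 * t ^ 2), abs_two]
        _ ≤ B₂ * (4 * e₀ ^ 2) + B₁ * 2 := by
            gcongr
            · exact hb2 _
            · exact hb1 _
        _ = 4 * e₀ ^ 2 * B₂ + 2 * B₁ := by ring
  have h := norm_second_difference_le (f := f) (f' := f') (f'' := f'') (x := ν) hδ (fun t _ => hf1 t) (fun t _ => hf2 t)
    (fun t _ => hbound t)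
  rw [Real.norm_eq_abs] at h
  simpa [hf, smul_eq_mul] using h

/-! ### §3 The momentum directions: `t ↦ G(ν² + a(t)²)·Z(t)` along a band line `a` with an angular factor `Z` -/

/-- **Second differences of the cutoff times an angular factor along a `C²` band line**: there are `B₁, B₂ ≥ 0` (the derivative bounds of
`G`, depending on `e₀` only) such that for every line `a` with `HasDerivAt a a′`, `HasDerivAt a′ a″`, `|a′|, |a″| ≤ D` and every factor `Z`
with `HasDerivAt Z Z′`, `HasDerivAt Z′ Z″`, `|Z| ≤ 1`, `|Z′| ≤ Z₁`, `|Z″| ≤ Z₂` on `[x, x+2δ]`,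
`|g(x+2δ) - 2g(x+δ) + g(x)| ≤ δ²·(4B₂e₀²D² + 2B₁(D² + e₀D) + 4B₁e₀D·Z₁ + Z₂)` for `g(t) = G(ν² + a(t)²)·Z(t)`
(where `G′, G″ ≠ 0` one has `a² ≤ ν² + a² ≤ e₀²`, so `|a| ≤ e₀`). [cite: BenfattoGiulianiMastropietro2006, §2.5 Lemma 2.2 (2.36aa)] -/
theorem exists_second_difference_line_le {e₀ : ℝ} (he : 0 < e₀) :
    ∃ B₁ B₂ : ℝ, 0 ≤ B₁ ∧ 0 ≤ B₂ ∧ ∀ (ν : ℝ) {D Z₁ Z₂ : ℝ}, 0 ≤ D → 0 ≤ Z₁ → 0 ≤ Z₂ →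
      ∀ (a a' a'' Z Z' Z'' : ℝ → ℝ) (x δ : ℝ), 0 ≤ δ →
        (∀ t ∈ Icc x (x + 2 * δ), HasDerivAt a (a' t) t) → (∀ t ∈ Icc x (x + 2 * δ), HasDerivAt a' (a'' t) t) →
        (∀ t ∈ Icc x (x + 2 * δ), |a' t| ≤ D) → (∀ t ∈ Icc x (x + 2 * δ), |a'' t| ≤ D) →
        (∀ t ∈ Icc x (x + 2 * δ), HasDerivAt Z (Z' t) t) → (∀ t ∈ Icc x (x + 2 * δ), HasDerivAt Z' (Z'' t) t) →
        (∀ t ∈ Icc x (x + 2 * δ), |Z t| ≤ 1) → (∀ t ∈ Icc x (x + 2 * δ), |Z' t| ≤ Z₁) → (∀ t ∈ Icc x (x + 2 * δ), |Z'' t| ≤ Z₂) →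
        |bgmCutoffSq e₀ (ν ^ 2 + a (x + 2 * δ) ^ 2) * Z (x + 2 * δ) - 2 * (bgmCutoffSq e₀ (ν ^ 2 + a (x + δ) ^ 2) * Z (x + δ)) +
            bgmCutoffSq e₀ (ν ^ 2 + a x ^ 2) * Z x| ≤
          δ ^ 2 * (4 * B₂ * e₀ ^ 2 * D ^ 2 + 2 * B₁ * (D ^ 2 + e₀ * D) + 4 * B₁ * e₀ * D * Z₁ + Z₂) := by
  obtain ⟨B₁, B₂, hB₁, hB₂, hd1, hd2, hb1, hb2, hzero⟩ := exists_deriv_bounds_bgmCutoffSq he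
  set G := bgmCutoffSq e₀ with hG
  refine ⟨B₁, B₂, hB₁, hB₂, fun ν D Z₁ Z₂ hD hZ₁ hZ₂ a a' a'' Z Z' Z'' x δ hδ ha ha' haD ha'D hZ hZ' hZ0 hZ1 hZ2 => ?_⟩
  -- the cutoff factor along the line and its derivatives
  set u : ℝ → ℝ := fun t => ν ^ 2 + a t ^ 2 with hu
  set u' : ℝ → ℝ := fun t => 2 * (a t * a' t) with hu'
  set u'' : ℝ → ℝ := fun t => 2 * (a' t * a' t + a t * a'' t) with hu''
  set c : ℝ → ℝ := fun t => G (u t) with hc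
  set c' : ℝ → ℝ := fun t => deriv G (u t) * u' t with hc'
  set c'' : ℝ → ℝ := fun t => deriv (deriv G) (u t) * u' t * u' t + deriv G (u t) * u'' t with hc''
  have hu1 : ∀ t ∈ Icc x (x + 2 * δ), HasDerivAt u (u' t) t := fun t ht => by
    have h := ((ha t ht).mul (ha t ht)).const_add (ν ^ 2)
    have hfun : (fun y => ν ^ 2 + (a * a) y) = u := by funext y; rw [hu, Pi.mul_apply]; ring
    have hval : a' t * a t + a t * a' t = u' t := by rw [hu']; ring
    rw [hfun, hval] at h
    exact h
  have hu2 : ∀ t ∈ Icc x (x + 2 * δ), HasDerivAt u' (u'' t) t := fun t ht =>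
    ((ha t ht).mul (ha' t ht)).const_mul 2
  have hc1 : ∀ t ∈ Icc x (x + 2 * δ), HasDerivAt c (c' t) t := fun t ht => by
    have h : HasDerivAt (G ∘ u) (deriv G (u t) * u' t) t := (hd1 (u t)).comp t (hu1 t ht)
    exact h
  have hc2 : ∀ t ∈ Icc x (x + 2 * δ), HasDerivAt c' (c'' t) t := fun t ht => by
    have h1 : HasDerivAt (deriv G ∘ u) (deriv (deriv G) (u t) * u' t) t := (hd2 (u t)).comp t (hu1 t ht)
    exact h1.mul (hu2 t ht)
  -- the product and its derivatives
  set g : ℝ → ℝ := fun t => c t * Z t with hg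
  set g' : ℝ → ℝ := fun t => c' t * Z t + c t * Z' t with hg'
  set g'' : ℝ → ℝ := fun t => c'' t * Z t + c' t * Z' t + (c' t * Z' t + c t * Z'' t) with hg''
  have hg1 : ∀ t ∈ Icc x (x + 2 * δ), HasDerivAt g (g' t) t := fun t ht => (hc1 t ht).mul (hZ t ht)
  have hg2 : ∀ t ∈ Icc x (x + 2 * δ), HasDerivAt g' (g'' t) t := fun t ht =>
    ((hc2 t ht).mul (hZ t ht)).add ((hc1 t ht).mul (hZ' t ht))
  -- pointwise bounds
  have hcval : ∀ t, |c t| ≤ 1 := fun t => abs_bgmCutoffSq_le_one e₀ _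
  have hkey : ∀ t ∈ Icc x (x + 2 * δ),
      |c' t| ≤ 2 * B₁ * e₀ * D ∧ |c'' t| ≤ 4 * B₂ * e₀ ^ 2 * D ^ 2 + 2 * B₁ * (D ^ 2 + e₀ * D) := by
    intro t ht
    have haD' := haD t ht
    have ha'D' := ha'D t ht
    by_cases hbig : e₀ ^ 2 < u t
    · rw [hc', hc'']
      dsimp only
      rw [(hzero _ hbig).1, (hzero _ hbig).2]
      simp only [zero_mul, zero_add, abs_zero]
      exact ⟨by positivity, by positivity⟩
    · have hat : |a t| ≤ e₀ := by
        have h1 : a t ^ 2 ≤ e₀ ^ 2 := by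
          have : u t ≤ e₀ ^ 2 := le_of_not_gt hbig
          rw [hu] at this; dsimp only at this; nlinarith [sq_nonneg ν]
        exact (sq_le_sq₀ (abs_nonneg _) he.le).1 (by rw [sq_abs]; exact h1)
      have hua : |u' t| ≤ 2 * e₀ * D := by
        rw [hu']; dsimp only
        rw [abs_mul, abs_mul, abs_two]
        calc 2 * (|a t| * |a' t|) ≤ 2 * (e₀ * D) := by gcongr
          _ = 2 * e₀ * D := by ring
      have hub : |u'' t| ≤ 2 * (D * D + e₀ * D) := by
        rw [hu'']; dsimp only
        rw [abs_mul, abs_two]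
        refine mul_le_mul_of_nonneg_left ?_ (by norm_num)
        calc |a' t * a' t + a t * a'' t| ≤ |a' t * a' t| + |a t * a'' t| := abs_add_le _ _
          _ = |a' t| * |a' t| + |a t| * |a'' t| := by rw [abs_mul, abs_mul]
          _ ≤ D * D + e₀ * D := by gcongr
      constructor
      · rw [hc']; dsimp only
        rw [abs_mul (deriv G (u t)) (u' t)]
        calc |deriv G (u t)| * |u' t| ≤ B₁ * (2 * e₀ * D) := mul_le_mul (hb1 _) hua (abs_nonneg _) hB₁
          _ = 2 * B₁ * e₀ * D := by ring
      · rw [hc'']; dsimp only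
        calc |deriv (deriv G) (u t) * u' t * u' t + deriv G (u t) * u'' t|
            ≤ |deriv (deriv G) (u t) * u' t * u' t| + |deriv G (u t) * u'' t| := abs_add_le _ _
          _ = |deriv (deriv G) (u t)| * |u' t| * |u' t| + |deriv G (u t)| * |u'' t| := by
              rw [abs_mul (deriv (deriv G) (u t) * u' t) (u' t), abs_mul (deriv (deriv G) (u t)) (u' t),
                abs_mul (deriv G (u t)) (u'' t)]
          _ ≤ B₂ * (2 * e₀ * D) * (2 * e₀ * D) + B₁ * (2 * (D * D + e₀ * D)) :=
              add_le_add (mul_le_mul (mul_le_mul (hb2 _) hua (abs_nonneg _) hB₂) hua (abs_nonneg _) (by positivity))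
                (mul_le_mul (hb1 _) hub (abs_nonneg _) hB₁)
          _ = 4 * B₂ * e₀ ^ 2 * D ^ 2 + 2 * B₁ * (D ^ 2 + e₀ * D) := by ring
  have hbound : ∀ t ∈ Icc x (x + 2 * δ), ‖g'' t‖ ≤ 4 * B₂ * e₀ ^ 2 * D ^ 2 + 2 * B₁ * (D ^ 2 + e₀ * D) + 4 * B₁ * e₀ * D * Z₁ + Z₂ := by
    intro t ht
    obtain ⟨h1, h2⟩ := hkey t ht
    rw [Real.norm_eq_abs, hg'']
    dsimp only
    calc |c'' t * Z t + c' t * Z' t + (c' t * Z' t + c t * Z'' t)|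
        ≤ |c'' t * Z t| + |c' t * Z' t| + (|c' t * Z' t| + |c t * Z'' t|) :=
          (abs_add_le _ _).trans (add_le_add (abs_add_le _ _) (abs_add_le _ _))
      _ = |c'' t| * |Z t| + |c' t| * |Z' t| + (|c' t| * |Z' t| + |c t| * |Z'' t|) := by
          simp only [abs_mul]
      _ ≤ (4 * B₂ * e₀ ^ 2 * D ^ 2 + 2 * B₁ * (D ^ 2 + e₀ * D)) * 1 + 2 * B₁ * e₀ * D * Z₁ +
          (2 * B₁ * e₀ * D * Z₁ + 1 * Z₂) := by
          gcongr
          · exact hZ0 t ht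
          · exact hZ1 t ht
          · exact hZ1 t ht
          · exact hcval t
          · exact hZ2 t ht
      _ = _ := by ring
  have h := norm_second_difference_le (f := g) (f' := g') (f'' := g'') (x := x) hδ hg1 hg2 hbound
  rw [Real.norm_eq_abs] at h
  simpa [hg, hc, hu, smul_eq_mul] using h

end Literature.MathematicalPhysics.QuantumLattice

end
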